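import Literature.Geometry.Lorentzian.KerrStarMultiplierIdentity
import HarnessLib

/-!
# The non-negative modified current `J^{N,−1/2}` near the extremal Kerr horizon: Aretakis's
# vector field `N`, the sign of its bulk on `𝓐_N = {M ≤ r ≤ 23M/21}` (JFA 2012, Prop. 7.2.1),
# the horizon flux, and the coercivity of its energy density

(family `gr`; namespace `Literature.Geometry.Lorentzian.Kerr.StarCoord`; written from the proving
seat of `Literature.Barriers.FinalStateConjecture.Aretakis2012_pointwiseDecay` — Aretakis, JFA 263
(2012), Thm. 5 — as the first of the ESTIMATES of the source: the near-horizon current used in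
§13.1 to prove the uniform boundedness of the non-degenerate energy (Thm. 2 of §3), which is
hypothesis (i) of `Aretakis2012_pointwiseDecay_of_uniformBoundedness_of_integratedDecay`.)

Aretakis (§7.2) sets `N = N^T(r) T + N^Y(r) Y` with `N^T = 18r − 35M/2`, `N^Y = −2r + M` on
`𝓐_N = {M ≤ r ≤ 23M/21}` and modifies the current to `J^{N,−1/2} = J^N − ½ψ∇ψ`; Prop. 7.2.1 states
`K^{N,−1/2}[ψ] ≥ C((Tψ)² + (1 − M/r)(Yψ)² + |∇̸ψ|²)` for axisymmetric `ψ` on `𝓐_N`. In the coordinate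
frame of `(t*, r, θ, φ*)` (`∂_r = Y + T`, `∂_{t*} = T`) this is the multiplier `f∂_r + h∂_{t*}` with
`f = N^Y = −2r + M` (`nProfileR`), `h = N^T − N^Y = 20r − 37M/2` (`nProfileT`) and Lagrangian
coefficient `w ≡ −½` (`nProfileW`) of `KerrStarMultiplierIdentity.lean`, where `K^{N,−1/2} ρ² sin θ =
−multBulk` and the energy density is `E_N = −multDensity` (conventions of `mult_box_identity`:
`E(t₂) + ∫∫∫(−multBulk) + ∫∫F(M) = E(t₁)` when nothing flows through the outer cylinder). This
file proves, on extremal Kerr `a = M`: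

* `multBulk_nCurrent` — the bulk in closed form:
  `−multBulk/sin θ = ½(r−M)(r+M)(∂_rG)² + 2(r−M)(10r−9M)∂_{t*}G∂_rG + (38Mr + M² − 5r²/2 − ½M²cos²θ)(∂_{t*}G)² + ½(∂_θG)²`;
* `neg_multBulk_nCurrent_ge` (**Prop. 7.2.1, with constants**): for `M ≤ r ≤ 23M/21`, `θ ∈ [0, π]`,
  `−multBulk ≥ sin θ (¼(r−M)(r+M)(∂_rG)² + 18M²(∂_{t*}G)² + ½(∂_θG)²)` (transversal weight
  degenerating to first order at `𝓗⁺`, as printed) — by the discriminant certificate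
  `quadForm_nonneg` and the polynomial inequality `nCurrent_poly_ineq`;
* `multFluxR_nCurrent_horizon`, `multFluxR_nCurrent_horizon_nonneg` — the horizon flux
  `F(t, M, θ) = sin θ (M³(3/2 − ½cos²θ)(∂_{t*}G)² + ½M(∂_θG)²) ≥ 0` (§13.1: the `𝓗⁺` term has
  the right sign);
* `neg_multDensity_nCurrent`, `nEnergy_quadratic_ge` — the energy density in closed form and the
  coercivity of its quadratic part,
  `E_N − ½ sin θ (4Mr G∂_rG + M G² − (ρ²+2Mr) G∂_{t*}G) ≥ sin θ (M³/8 (∂_rG)² + h(ρ²+2Mr)/16 (∂_{t*}G)² + ½h(∂_θG)²)`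
  ("`N` is future directed timelike in `𝓐_N`"; non-degenerate in `∂_r` up to the horizon), by
  `nEnergy_poly_ineq`; the zeroth-order terms are the business of the Hardy inequalities (§4.4,
  used in §13.1).

Everything is proved (closed forms by `ring` from the definitions of `KerrStarMultiplierIdentity.lean`;
inequalities by `nlinarith` on `[M, 23M/21]`); no named facts. Not covered here: the extension of `N`
beyond `23M/21` (§13.1: cut-off `δ`, errors in the transition region controlled by the integrated
decay estimate, Thm. 1) and the Hardy inequalities.

## References

* S. Aretakis, *Decay of axisymmetric solutions of the wave equation on extreme Kerr backgrounds*,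
  J. Funct. Anal. 263 (2012) 2770–2831 (arXiv:1110.2006): §7.2 ((7.4) the field `N`, (7.5) the
  current `J^{N,−1/2}`, Prop. 7.2.1 and its proof: `G_TT ≥ 18`, `G_∇̸ = ½`, `ε₁² ≤ G_YY ⇔ r ≤ 4M/3`,
  `ε₂² ≤ G_TT ⇔ r ≤ 23M/21`), §13.1 (use in the boundedness of the non-degenerate energy)
  (key `Aretakis2012`).
* S. Aretakis, *Stability and instability of extreme Reissner–Nordström black hole spacetimes for
  linear scalar perturbations I*, Comm. Math. Phys. 307 (2011) 17–63, where such currents first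
  appeared (cited through Aretakis 2012, §7.2).
-/

noncomputable section

open Real Set Filter
open scoped Topology ContDiff

namespace Literature.Geometry.Lorentzian

namespace Kerr

namespace StarCoord

/-! ### The profiles of Aretakis's vector field `N` -/

/-- The `∂_r`-component of Aretakis's vector field `N = N^T T + N^Y Y` near the extremal horizon,
`N^Y = −2r + M` (in the coordinate frame `∂_r = Y + T`, `∂_{t*} = T` of `(t*, r, θ, φ*)` the field is
`N = N^Y ∂_r + (N^T − N^Y) ∂_{t*}`). [cite: Aretakis2012, §7.2 (7.4)] -/
def nProfileR (M : ℝ) : ℝ → ℝ := fun r ↦ -2 * r + M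

/-- The `∂_{t*}`-component `N^T − N^Y = 20r − 37M/2` of Aretakis's `N` (`N^T = 18r − 35M/2`).
[cite: Aretakis2012, §7.2 (7.4)] -/
def nProfileT (M : ℝ) : ℝ → ℝ := fun r ↦ 20 * r - 37 / 2 * M

/-- The Lagrangian coefficient `−½` of the modified current `J^{N,−1/2} = J^N − ½ ψ∇ψ`.
[cite: Aretakis2012, §7.2 (7.5)] -/
def nProfileW : ℝ → ℝ := fun _ ↦ -1 / 2

/-- `(N^Y)' = −2`. [folklore] -/
theorem hasDerivAt_nProfileR (M r : ℝ) : HasDerivAt (nProfileR M) (-2) r := by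
  unfold nProfileR
  simpa using ((hasDerivAt_id r).const_mul (-2)).add_const M

/-- `(N^T − N^Y)' = 20`. [folklore] -/
theorem hasDerivAt_nProfileT (M r : ℝ) : HasDerivAt (nProfileT M) 20 r := by
  unfold nProfileT
  simpa using ((hasDerivAt_id r).const_mul 20).sub_const (37 / 2 * M)

/-- `(N^Y)' = −2` as a `deriv`. [folklore] -/
theorem deriv_nProfileR (M : ℝ) : deriv (nProfileR M) = fun _ ↦ -2 :=
  funext fun r ↦ (hasDerivAt_nProfileR M r).deriv

/-- `(N^T − N^Y)' = 20` as a `deriv`. [folklore] -/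
theorem deriv_nProfileT (M : ℝ) : deriv (nProfileT M) = fun _ ↦ 20 :=
  funext fun r ↦ (hasDerivAt_nProfileT M r).deriv

/-- The Lagrangian coefficient is constant. [folklore] -/
theorem deriv_nProfileW : deriv nProfileW = fun _ ↦ 0 := by
  unfold nProfileW; funext r; simp

/-- Smoothness of the profile. [folklore] -/
theorem contDiff_nProfileR (M : ℝ) : ContDiff ℝ ∞ (nProfileR M) := by
  unfold nProfileR; fun_prop

/-- Smoothness of the profile. [folklore] -/
theorem contDiff_nProfileT (M : ℝ) : ContDiff ℝ ∞ (nProfileT M) := by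
  unfold nProfileT; fun_prop

/-- Smoothness of the profile. [folklore] -/
theorem contDiff_nProfileW : ContDiff ℝ ∞ nProfileW := by
  unfold nProfileW; exact contDiff_const

/-! ### The bulk of `J^{N,−1/2}` on extremal Kerr, in closed form -/

/-- **The bulk term of the modified `N`-current on extremal Kerr `a = M`, in closed form**
(`K^{N,−1/2} ρ² sin θ = −multBulk` in the convention of `KerrStarMultiplierIdentity.lean`):
`multBulk = sin θ [−½(r−M)(r+M)(∂_rG)² − 2(r−M)(10r−9M)∂_{t*}G∂_rG + (5r²/2 − 38Mr − M² + ½M²cos²θ)(∂_{t*}G)² − ½(∂_θG)²]`.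
[cite: Aretakis2012, §7.2 (Prop. 7.2.1)] -/
theorem multBulk_nCurrent (M : ℝ) (G : E4 → ℝ) (q : E4) :
    multBulk M M (nProfileR M) (nProfileT M) nProfileW G q =
      sin (q 2) * (-(1 / 2 * (q 1 - M) * (q 1 + M)) * pd 1 G q ^ 2 -
        2 * (q 1 - M) * (10 * q 1 - 9 * M) * pd 0 G q * pd 1 G q +
        (5 / 2 * q 1 ^ 2 - 38 * M * q 1 - M ^ 2 + 1 / 2 * M ^ 2 * cos (q 2) ^ 2) * pd 0 G q ^ 2 -
        1 / 2 * pd 2 G q ^ 2) := by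
  simp only [multBulk, radMultBulk, lagBulk, tFluxR, deriv_nProfileR, deriv_nProfileT, deriv_nProfileW,
    nProfileR, nProfileW, deriv_const']
  ring

/-- **The horizon flux of `J^{N,−1/2}` on extremal Kerr is non-negative** (`r = M`: `f(M) = −M`,
`h(M) = 3M/2`): `F(t, M, θ) = sin θ (M³(3/2 − ½cos²θ)(∂_{t*}G)² + ½M(∂_θG)²) ≥ 0` for
`θ ∈ [0, π]`, `M ≥ 0`. [cite: Aretakis2012, §13.1] -/
theorem multFluxR_nCurrent_horizon (M : ℝ) (G : E4 → ℝ) {q : E4} (hq : q 1 = M) :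
    multFluxR M M (nProfileR M) (nProfileT M) nProfileW G q =
      sin (q 2) * (M ^ 3 * (3 / 2 - 1 / 2 * cos (q 2) ^ 2) * pd 0 G q ^ 2 + 1 / 2 * M * pd 2 G q ^ 2) := by
  simp only [multFluxR, radMultFluxR, timeMultFluxR, lagFluxR, tFluxR, deriv_nProfileW, nProfileR,
    nProfileT, nProfileW, hq]
  ring

/-- **The horizon flux of `J^{N,−1/2}` is non-negative** for `θ ∈ [0, π]`, `M ≥ 0` (§13.1: the
`𝓗⁺` boundary term has the right sign). [cite: Aretakis2012, §13.1] -/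
theorem multFluxR_nCurrent_horizon_nonneg {M : ℝ} (hM : 0 ≤ M) (G : E4 → ℝ) {q : E4} (hq : q 1 = M)
    (hθ : q 2 ∈ Icc 0 π) :
    0 ≤ multFluxR M M (nProfileR M) (nProfileT M) nProfileW G q := by
  rw [multFluxR_nCurrent_horizon M G hq]
  have hs : 0 ≤ sin (q 2) := sin_nonneg_of_nonneg_of_le_pi hθ.1 hθ.2
  have hc : cos (q 2) ^ 2 ≤ 1 := by nlinarith [sin_sq_add_cos_sq (q 2), sq_nonneg (sin (q 2))]
  refine mul_nonneg hs (add_nonneg (mul_nonneg (mul_nonneg (pow_nonneg hM 3) (by nlinarith)) (sq_nonneg _))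
    (mul_nonneg (by positivity) (sq_nonneg _)))

/-! ### Prop. 7.2.1: non-negativity (indeed coercivity) of `K^{N,−1/2}` on `𝓐_N = {M ≤ r ≤ 23M/21}` -/

/-- The polynomial inequality behind the coercivity: on `[M, 23M/21]`,
`(r + M)(38Mr − 17M² − 5r²/2 − ½M²c²) ≥ 4(r − M)(10r − 9M)²` for `c² ≤ 1`, `M > 0`
(substitute `r = M + u`, `0 ≤ u ≤ 2M/21`: the difference is
`37M³ − M³c² + (161/2)M²u − ½M²uc² − 52Mu² − (805/2)u³ ≥ 36M³ + 71M²u`). [folklore] -/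
theorem nCurrent_poly_ineq {M r cc : ℝ} (hM : 0 < M) (hr : M ≤ r) (hr' : r ≤ 23 / 21 * M)
    (hcc' : cc ≤ 1) :
    4 * (r - M) * (10 * r - 9 * M) ^ 2 ≤
      (r + M) * (38 * M * r - 17 * M ^ 2 - 5 / 2 * r ^ 2 - 1 / 2 * M ^ 2 * cc) := by
  obtain ⟨u, rfl⟩ : ∃ u, r = M + u := ⟨r - M, by ring⟩
  have hu0 : 0 ≤ u := by linarith
  have hu1 : u ≤ 2 / 21 * M := by linarith
  have e : (M + u + M) * (38 * M * (M + u) - 17 * M ^ 2 - 5 / 2 * (M + u) ^ 2 - 1 / 2 * M ^ 2 * cc) -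
      4 * (M + u - M) * (10 * (M + u) - 9 * M) ^ 2 =
      37 * M ^ 3 - M ^ 3 * cc + 161 / 2 * (M ^ 2 * u) - 1 / 2 * (M ^ 2 * u) * cc - 52 * (M * u ^ 2) -
        805 / 2 * u ^ 3 := by ring
  have t1 : M ^ 3 * cc ≤ M ^ 3 := mul_le_of_le_one_right (pow_nonneg hM.le 3) hcc'
  have t2 : M ^ 2 * u * cc ≤ M ^ 2 * u := mul_le_of_le_one_right (by positivity) hcc'
  have t3 : M * u ^ 2 ≤ 2 / 21 * (M ^ 2 * u) := by
    have h : 0 ≤ M * u * (2 / 21 * M - u) := mul_nonneg (mul_nonneg hM.le hu0) (by linarith)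
    nlinarith
  have t4 : u ^ 3 ≤ 4 / 441 * (M ^ 2 * u) := by
    have hsq : u ^ 2 ≤ (2 / 21 * M) ^ 2 := pow_le_pow_left₀ hu0 hu1 2
    have h : 0 ≤ u * ((2 / 21 * M) ^ 2 - u ^ 2) := mul_nonneg hu0 (by linarith)
    nlinarith
  have t5 : 0 ≤ M ^ 2 * u := by positivity
  have t6 : 0 ≤ M ^ 3 := by positivity
  nlinarith [e, t1, t2, t3, t4, t5, t6]

/-- A non-negative discriminant makes a binary quadratic form with non-negative diagonal
non-negative: `4α(αx² + βyx + γy²) = (2αx + βy)² + (4αγ − β²)y²`. [folklore] -/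
theorem quadForm_nonneg {α β γ x y : ℝ} (hα : 0 ≤ α) (hγ : 0 ≤ γ) (hdisc : β ^ 2 ≤ 4 * α * γ) :
    0 ≤ α * x ^ 2 + β * y * x + γ * y ^ 2 := by
  rcases hα.eq_or_lt with hα0 | hαpos
  · have hβ : β = 0 := by
      rw [← hα0] at hdisc
      nlinarith [sq_nonneg β]
    rw [← hα0, hβ]
    nlinarith [sq_nonneg y]
  · have key : 4 * α * (α * x ^ 2 + β * y * x + γ * y ^ 2) =
        (2 * α * x + β * y) ^ 2 + (4 * α * γ - β ^ 2) * y ^ 2 := by ring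
    have hS : 0 ≤ (2 * α * x + β * y) ^ 2 + (4 * α * γ - β ^ 2) * y ^ 2 :=
      add_nonneg (sq_nonneg _) (mul_nonneg (by linarith) (sq_nonneg _))
    nlinarith

/-- **Prop. 7.2.1 (Aretakis 2012): the bulk of `J^{N,−1/2}` has a sign on `𝓐_N`, with coercivity.**
For `M ≤ r ≤ 23M/21`, `θ ∈ [0, π]`, `M > 0`:
`−multBulk ≥ sin θ (¼(r−M)(r+M)(∂_rG)² + 18M²(∂_{t*}G)² + ½(∂_θG)²)` — i.e.
`K^{N,−1/2}[ψ] ≥ C((Tψ)² + (1 − M/r)(Yψ)² + |∇̸ψ|²)` in the coordinates of the paper (the transversal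
weight degenerating to first order at `𝓗⁺`). Proof: after subtracting the right-hand side the
remaining quadratic form `α(∂_rG)² + β∂_{t*}G∂_rG + γ(∂_{t*}G)²` has `α = ¼(r−M)(r+M) ≥ 0`, `γ ≥ 0`
and `4αγ ≥ β²` (`nCurrent_poly_ineq`), hence is non-negative (`quadForm_nonneg`).
[cite: Aretakis2012, §7.2 (Prop. 7.2.1)] -/
theorem neg_multBulk_nCurrent_ge {M : ℝ} (hM : 0 < M) (G : E4 → ℝ) {q : E4} (hr : M ≤ q 1)
    (hr' : q 1 ≤ 23 / 21 * M) (hθ : q 2 ∈ Icc 0 π) :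
    sin (q 2) * (1 / 4 * (q 1 - M) * (q 1 + M) * pd 1 G q ^ 2 + 18 * M ^ 2 * pd 0 G q ^ 2 +
        1 / 2 * pd 2 G q ^ 2) ≤
      -multBulk M M (nProfileR M) (nProfileT M) nProfileW G q := by
  rw [multBulk_nCurrent]
  have hs : 0 ≤ sin (q 2) := sin_nonneg_of_nonneg_of_le_pi hθ.1 hθ.2
  have hcc1 : cos (q 2) ^ 2 ≤ 1 := by
    have := sin_sq_add_cos_sq (q 2); nlinarith [sq_nonneg (sin (q 2))]
  -- the residual quadratic form `α x² + β y x + γ y²`, `x = ∂_rG`, `y = ∂_{t*}G`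
  have hα0 : 0 ≤ 1 / 4 * (q 1 - M) * (q 1 + M) := by nlinarith
  have hγ0 : 0 ≤ 38 * M * q 1 - 17 * M ^ 2 - 5 / 2 * q 1 ^ 2 - 1 / 2 * M ^ 2 * cos (q 2) ^ 2 := by
    nlinarith [mul_pos hM hM]
  have hdisc : (2 * (q 1 - M) * (10 * q 1 - 9 * M)) ^ 2 ≤
      4 * (1 / 4 * (q 1 - M) * (q 1 + M)) *
        (38 * M * q 1 - 17 * M ^ 2 - 5 / 2 * q 1 ^ 2 - 1 / 2 * M ^ 2 * cos (q 2) ^ 2) := by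
    have h := nCurrent_poly_ineq (cc := cos (q 2) ^ 2) hM hr hr' hcc1
    have h1 : 0 ≤ q 1 - M := by linarith
    nlinarith [mul_nonneg h1 (sub_nonneg.mpr h)]
  have hR := quadForm_nonneg (x := pd 1 G q) (y := pd 0 G q) hα0 hγ0 hdisc
  have e : -(sin (q 2) * (-(1 / 2 * (q 1 - M) * (q 1 + M)) * pd 1 G q ^ 2 -
      2 * (q 1 - M) * (10 * q 1 - 9 * M) * pd 0 G q * pd 1 G q +
      (5 / 2 * q 1 ^ 2 - 38 * M * q 1 - M ^ 2 + 1 / 2 * M ^ 2 * cos (q 2) ^ 2) * pd 0 G q ^ 2 -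
      1 / 2 * pd 2 G q ^ 2)) -
      sin (q 2) * (1 / 4 * (q 1 - M) * (q 1 + M) * pd 1 G q ^ 2 + 18 * M ^ 2 * pd 0 G q ^ 2 +
        1 / 2 * pd 2 G q ^ 2) =
      sin (q 2) * (1 / 4 * (q 1 - M) * (q 1 + M) * pd 1 G q ^ 2 +
        2 * (q 1 - M) * (10 * q 1 - 9 * M) * pd 0 G q * pd 1 G q +
        (38 * M * q 1 - 17 * M ^ 2 - 5 / 2 * q 1 ^ 2 - 1 / 2 * M ^ 2 * cos (q 2) ^ 2) * pd 0 G q ^ 2) := by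
    ring
  nlinarith [mul_nonneg hs hR, e]

/-! ### The `N`-energy density: closed form and coercivity of its quadratic part -/

/-- **The `t*`-density of `J^{N,−1/2}` on extremal Kerr in closed form** (`E_N = −multDensity` in
the convention of `mult_box_identity`):
`−multDensity = sin θ [((2r−M)2Mr + ½h(r−M)²)(∂_rG)² − (2r−M)(ρ²+2Mr)∂_rG∂_{t*}G + ½h(ρ²+2Mr)(∂_{t*}G)²
  + ½h(∂_θG)²] + ½ sin θ (4Mr G∂_rG + M G² − (ρ²+2Mr) G∂_{t*}G)`, `h = 20r − 37M/2`.
[cite: Aretakis2012, §7.2] -/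
theorem neg_multDensity_nCurrent (M : ℝ) (G : E4 → ℝ) (q : E4) :
    -multDensity M M (nProfileR M) (nProfileT M) nProfileW G q =
      sin (q 2) * (((2 * q 1 - M) * (2 * M * q 1) + 1 / 2 * (20 * q 1 - 37 / 2 * M) * (q 1 - M) ^ 2) *
          pd 1 G q ^ 2 -
        (2 * q 1 - M) * (q 1 ^ 2 + M ^ 2 * cos (q 2) ^ 2 + 2 * M * q 1) * pd 1 G q * pd 0 G q +
        1 / 2 * (20 * q 1 - 37 / 2 * M) * (q 1 ^ 2 + M ^ 2 * cos (q 2) ^ 2 + 2 * M * q 1) * pd 0 G q ^ 2 +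
        1 / 2 * (20 * q 1 - 37 / 2 * M) * pd 2 G q ^ 2) +
      1 / 2 * sin (q 2) * (4 * M * q 1 * G q * pd 1 G q + M * G q ^ 2 -
        (q 1 ^ 2 + M ^ 2 * cos (q 2) ^ 2 + 2 * M * q 1) * G q * pd 0 G q) := by
  simp only [multDensity, radMultDensity, timeMultDensity, lagDensity, tEnergy, nProfileR, nProfileT,
    nProfileW]
  ring

/-- The polynomial inequality behind the coercivity of the `N`-energy: on `[M, 23M/21]`, `c² ≤ 1`,
`(2r − M)²(r² + M²c² + 2Mr) ≤ (7/4) h ((2r − M)2Mr + ½h(r − M)² − M³/8)`, `h = 20r − 37M/2`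
(`c² ≤ 1`). [folklore] -/
theorem nEnergy_poly_ineq {M r cc : ℝ} (hM : 0 < M) (hr : M ≤ r) (hr' : r ≤ 23 / 21 * M)
    (hcc' : cc ≤ 1) :
    (2 * r - M) ^ 2 * (r ^ 2 + M ^ 2 * cc + 2 * M * r) ≤
      7 / 4 * (20 * r - 37 / 2 * M) *
        ((2 * r - M) * (2 * M * r) + 1 / 2 * (20 * r - 37 / 2 * M) * (r - M) ^ 2 - M ^ 3 / 8) := by
  obtain ⟨u, rfl⟩ : ∃ u, r = M + u := ⟨r - M, by ring⟩
  have hu0 : 0 ≤ u := by linarith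
  have hu1 : u ≤ 2 / 21 * M := by linarith
  have t1 : (2 * (M + u) - M) ^ 2 * (M ^ 2 * cc) ≤ (2 * (M + u) - M) ^ 2 * M ^ 2 :=
    by nlinarith [mul_le_of_le_one_right (mul_nonneg (sq_nonneg (2 * (M + u) - M)) (sq_nonneg M)) hcc']
  nlinarith [t1, mul_nonneg hu0 hM.le, mul_nonneg (mul_nonneg hu0 hM.le) hM.le,
    mul_nonneg (mul_nonneg hu0 hu0) hM.le, pow_nonneg hu0 3, mul_pos hM hM, pow_pos hM 3,
    mul_nonneg (mul_nonneg hu0 hM.le) (sub_nonneg.mpr hu1), mul_nonneg hu0 (sub_nonneg.mpr hu1)]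

/-- **The `N`-energy density controls the non-degenerate energy** (the field `N` is future-directed
timelike on `𝓐_N`, Aretakis 2012, §7.2): for `M ≤ r ≤ 23M/21`, `θ ∈ [0, π]`, `M > 0`, the quadratic
part of `E_N = −multDensity` satisfies
`E_N − ½ sin θ (4Mr G∂_rG + M G² − (ρ²+2Mr) G∂_{t*}G) ≥ sin θ (M³/8 (∂_rG)² + h(ρ²+2Mr)/16 (∂_{t*}G)² + ½h(∂_θG)²)`
— non-degenerate in the transversal derivative `∂_r` up to and including the horizon (the
zeroth-order terms are treated by the Hardy inequalities of §4.4 of the source, `§13.1`).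
[cite: Aretakis2012, §7.2 and §13.1] -/
theorem nEnergy_quadratic_ge {M : ℝ} (hM : 0 < M) (G : E4 → ℝ) {q : E4} (hr : M ≤ q 1)
    (hr' : q 1 ≤ 23 / 21 * M) (hθ : q 2 ∈ Icc 0 π) :
    sin (q 2) * (M ^ 3 / 8 * pd 1 G q ^ 2 +
        (20 * q 1 - 37 / 2 * M) * (q 1 ^ 2 + M ^ 2 * cos (q 2) ^ 2 + 2 * M * q 1) / 16 * pd 0 G q ^ 2 +
        1 / 2 * (20 * q 1 - 37 / 2 * M) * pd 2 G q ^ 2) ≤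
      -multDensity M M (nProfileR M) (nProfileT M) nProfileW G q -
        1 / 2 * sin (q 2) * (4 * M * q 1 * G q * pd 1 G q + M * G q ^ 2 -
          (q 1 ^ 2 + M ^ 2 * cos (q 2) ^ 2 + 2 * M * q 1) * G q * pd 0 G q) := by
  rw [neg_multDensity_nCurrent]
  have hs : 0 ≤ sin (q 2) := sin_nonneg_of_nonneg_of_le_pi hθ.1 hθ.2
  have hcc1 : cos (q 2) ^ 2 ≤ 1 := by
    have := sin_sq_add_cos_sq (q 2); nlinarith [sq_nonneg (sin (q 2))]
  have hh : 0 ≤ 20 * q 1 - 37 / 2 * M := by linarith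
  have hSig : 0 ≤ q 1 ^ 2 + M ^ 2 * cos (q 2) ^ 2 + 2 * M * q 1 := by nlinarith [mul_pos hM hM]
  -- residual quadratic form in `x = ∂_rG`, `y = ∂_{t*}G`
  have hα0 : 0 ≤ (2 * q 1 - M) * (2 * M * q 1) + 1 / 2 * (20 * q 1 - 37 / 2 * M) * (q 1 - M) ^ 2 -
      M ^ 3 / 8 := by nlinarith [mul_pos hM hM, mul_nonneg hh (sq_nonneg (q 1 - M))]
  have hγ0 : 0 ≤ 7 / 16 * (20 * q 1 - 37 / 2 * M) * (q 1 ^ 2 + M ^ 2 * cos (q 2) ^ 2 + 2 * M * q 1) :=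
    by positivity
  have hdisc : (-((2 * q 1 - M) * (q 1 ^ 2 + M ^ 2 * cos (q 2) ^ 2 + 2 * M * q 1))) ^ 2 ≤
      4 * ((2 * q 1 - M) * (2 * M * q 1) + 1 / 2 * (20 * q 1 - 37 / 2 * M) * (q 1 - M) ^ 2 - M ^ 3 / 8) *
        (7 / 16 * (20 * q 1 - 37 / 2 * M) * (q 1 ^ 2 + M ^ 2 * cos (q 2) ^ 2 + 2 * M * q 1)) := by
    have h := nEnergy_poly_ineq (cc := cos (q 2) ^ 2) hM hr hr' hcc1
    nlinarith [mul_nonneg hSig (sub_nonneg.mpr h)]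
  have hR := quadForm_nonneg (x := pd 1 G q) (y := pd 0 G q) hα0 hγ0 hdisc
  nlinarith [mul_nonneg hs hR]

/-- On `𝓐_N` the timelike coefficient `N^T − N^Y = 20r − 37M/2` of the vector field `N` is bounded
below by `3M/2 > 0` (so `N` is future-directed timelike there, §7.2). [cite: Aretakis2012, §7.2] -/
theorem nProfileT_ge {M r : ℝ} (hr : M ≤ r) : 3 / 2 * M ≤ nProfileT M r := by
  simp only [nProfileT]; linarith

/-- On the horizon `N^Y(M) = −M`: the transversal component of `N` points inwards
(`Y = ∂_r − ∂_{t*}` direction with coefficient `−(−M) > 0` for `M > 0`). [cite: Aretakis2012, §7.2] -/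
theorem nProfileR_horizon (M : ℝ) : nProfileR M M = -M := by
  simp only [nProfileR]; ring

end StarCoord

end Kerr

end Literature.Geometry.Lorentzian

end
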